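import Mathlib
import Summits.NavierStokesRegularity.NavierStokesRegularity.Theorems.TaoLadderRungTwoBreakBlowupRigidityOneVoidTables
import HarnessLib

/-!
# Where K2(1) lives: `TaoLadderRungTwoBreak.BlowupRigidityOne` (stmt-NavierStokesRegularity-20206) — and the
  rung leaf `Target` — are EQUIVALENT to their restrictions to LIVE data: tables with `fluxConst α ≥ R⁻¹` and a
  charged datum `X₀ ≠ 0`

MODEL lattice ODEs only (Tao 2016 §4 Thm. 4.2 statement shape, Lemma 4.1 (4.5)–(4.8)); nothing here is a statement
about the Navier–Stokes equations; NO item is closed (`--supports stmt-NavierStokesRegularity-20206`). DEF-FREE; by-name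
normal forms over the route file.

* `not_noGlobalCascade_of_datum_zero` — the uncharged datum `X₀ = 0` never blows up robustly (the zero family is a
  global exact (4.5)-regular flow; `noRegularExactFlow_of_noGlobalCascade`), any table of `E₂(R)`, any `ε₀ > 0`;
* `live_of_noGlobalCascade` — with `fluxConst_ge_of_noGlobalCascade` (VoidTables): a robust blow-up on `E₂(R)` has
  `R⁻¹ ≤ fluxConst α` AND `X₀ ≠ 0`;
* `blowupRigidityOne_iff_live` — **K2(1) ⟺ K2(1) restricted to live data** (`R⁻¹ ≤ fluxConst α`, `X₀ ≠ 0`): the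
  crux's content sits entirely on tables with a forward coupling of size `≥ 1/R` lit by a non-zero one-shell datum;
* `target_iff_live` — the same normal form for the rung leaf `Target` (BP-D-latt): no robust blow-up below `ε_R`
  need only be shown for live data.

HONEST LABEL: bookkeeping normal forms for the planner (which sub-class any proof or refutation of K2(1) / the Target
must address); no stub, crux or summit is proved; rung 0.
-/

noncomputable section

-- the summit and its single sub-problem share the name (CONVENTIONS §1)
set_option linter.dupNamespace false

open Set Filter Topology MeasureTheory

namespace Summit.NavierStokesRegularity.NavierStokesRegularity.Theorems

namespace BlowupRigidityOne

open Literature.Analysis.FluidPDE Literature.Analysis.FluidPDE.TaoCascade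
open Summit.NavierStokesRegularity.NavierStokesRegularity.Theses.TaoLadderRungTwoBreak

variable {m : ℕ}

/-- **The uncharged datum never blows up robustly.** For `ε₀ > 0`, `α ∈ E₂(R)` and `X₀ = 0`, `NoGlobalCascade ε₀ α 0`
FAILS: the zero family is an exact (4.5)-regular flow on every `[0,T]` from the zero datum, which a robust blow-up
forbids (`noRegularExactFlow_of_noGlobalCascade`).
[cite: Tao2016AveragedNS, §4 Thm. 4.2 (statement shape), Lemma 4.1 (4.5)–(4.8); cell vocabulary (`NoGlobalCascade`)] -/
theorem not_noGlobalCascade_of_datum_zero {ε₀ R : ℝ}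
    {α : Fin m → Fin m → Fin m → ℤ × ℤ × ℤ → ℝ} (hε : 0 < ε₀) (hα : InTableClass R α) :
    ¬ NoGlobalCascade ε₀ α (fun _ => 0) := by
  intro hNG
  obtain ⟨T, _, hno⟩ := noRegularExactFlow_of_noGlobalCascade hε hα hNG
  refine hno ⟨fun _ _ _ => 0, fun i k => by simp, fun i k t _ => ?_, ⟨0, fun t _ i k => by simp⟩⟩
  have hq : quadTerm ε₀ α (fun _ _ _ => (0 : ℝ)) i k t = 0 := by simp [quadTerm]
  rw [hq]
  exact hasDerivWithinAt_const _ _ _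

/-- **Robust blow-ups are live.** On `E₂(R)` (`ε₀ > 0`), `NoGlobalCascade ε₀ α X₀` forces a forward coupling
`R⁻¹ ≤ fluxConst α` (`fluxConst_ge_of_noGlobalCascade`) and a charged datum `X₀ ≠ 0`.
[cite: Tao2016AveragedNS, §4 Thm. 4.2 (statement shape), §6.1; cell vocabulary (`NoGlobalCascade`, `fluxConst`)] -/
theorem live_of_noGlobalCascade {ε₀ R : ℝ}
    {α : Fin m → Fin m → Fin m → ℤ × ℤ × ℤ → ℝ} {X₀ : Fin m → ℝ} (hε : 0 < ε₀) (hα : InTableClass R α)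
    (hNG : NoGlobalCascade ε₀ α X₀) : R⁻¹ ≤ fluxConst α ∧ X₀ ≠ 0 := by
  refine ⟨fluxConst_ge_of_noGlobalCascade hε hα hNG, fun h0 => ?_⟩
  subst h0
  exact not_noGlobalCascade_of_datum_zero hε hα hNG

/-- **K2(1) ⟺ K2(1) ON LIVE DATA.** `BlowupRigidityOne` is equivalent to the same implication demanded only of
tables `α ∈ E₂(R)` with `R⁻¹ ≤ fluxConst α` and data `X₀ ≠ 0` — the complement carries no robust blow-up
(`live_of_noGlobalCascade`).
[cite: Tao2016AveragedNS, §4 Thm. 4.2 (statement shape); cell vocabulary (K2(1))] -/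
theorem blowupRigidityOne_iff_live :
    BlowupRigidityOne ↔
      ∀ R : ℝ, 1 ≤ R → ∃ εs : ℝ, 0 < εs ∧ ∀ ε₀ : ℝ, 0 < ε₀ → ε₀ ≤ εs →
        ∀ (α : Fin 4 → Fin 4 → Fin 4 → ℤ × ℤ × ℤ → ℝ) (X₀ : Fin 4 → ℝ),
          InTableClass R α → R⁻¹ ≤ fluxConst α → X₀ ≠ 0 → NoGlobalCascade ε₀ α X₀ →
            ∃ (q : ℕ) (π : Equiv.Perm (Fin q)) (T : ℝ) (Φ : Fin q → ℝ → Em 4),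
              IsDSSWave ε₀ α π T Φ ∧ Surviving 1 ε₀ T ∧ ∃ r x, Φ r x ≠ 0 := by
  constructor
  · intro h R hR
    obtain ⟨εs, hεs, H⟩ := h R hR
    exact ⟨εs, hεs, fun ε₀ hε hle α X₀ hα _ _ hNG => H ε₀ hε hle α X₀ hα hNG⟩
  · intro h R hR
    obtain ⟨εs, hεs, H⟩ := h R hR
    refine ⟨εs, hεs, fun ε₀ hε hle α X₀ hα hNG => ?_⟩
    obtain ⟨hflux, hX₀⟩ := live_of_noGlobalCascade hε hα hNG
    exact H ε₀ hε hle α X₀ hα hflux hX₀ hNG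

/-- **The rung leaf ⟺ the rung leaf ON LIVE DATA.** `Target` (BP-D-latt: below `ε_R` no table of `E₂(R)` blows up
robustly from a one-shell datum) is equivalent to the same statement demanded only of tables with
`R⁻¹ ≤ fluxConst α` and data `X₀ ≠ 0`.
[cite: Tao2016AveragedNS, §4 Thm. 4.2 (statement shape); cell vocabulary (`Target` = `RungTwoBreakLatt`)] -/
theorem target_iff_live :
    Target ↔
      ∀ R : ℝ, 1 ≤ R → ∃ εR : ℝ, 0 < εR ∧ ∀ ε₀ : ℝ, 0 < ε₀ → ε₀ ≤ εR →
        ∀ (α : Fin 4 → Fin 4 → Fin 4 → ℤ × ℤ × ℤ → ℝ) (X₀ : Fin 4 → ℝ),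
          InTableClass R α → R⁻¹ ≤ fluxConst α → X₀ ≠ 0 → ¬ NoGlobalCascade ε₀ α X₀ := by
  constructor
  · intro h R hR
    obtain ⟨εR, hεR, H⟩ := h R hR
    exact ⟨εR, hεR, fun ε₀ hε hle α X₀ hα _ _ => H ε₀ hε hle α X₀ hα⟩
  · intro h R hR
    obtain ⟨εR, hεR, H⟩ := h R hR
    refine ⟨εR, hεR, fun ε₀ hε hle α X₀ hα hNG => ?_⟩
    obtain ⟨hflux, hX₀⟩ := live_of_noGlobalCascade hε hα hNG
    exact H ε₀ hε hle α X₀ hα hflux hX₀ hNG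

end BlowupRigidityOne

end Summit.NavierStokesRegularity.NavierStokesRegularity.Theorems

end
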